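import Literature.Topology.FourManifolds.SphereFamilySurgery
import Literature.Topology.FourManifolds.HalfSpaceChartedEmbedding
import Literature.Topology.FourManifolds.CircleSurgeryExistence
import HarnessLib

/-!
# Surgery along a framed family of spheres in a manifold with boundary: the construction

Topic `Literature/Topology/FourManifolds` (fact seat `provefact-…` of
`Literature.Topology.FourManifolds.HomotopySphere.exists_highlyConnected_of_mem_signatureSet`,
Kosinski's Thm. X.2.2: framed surgery below the middle dimension on a manifold bounded by a
homotopy sphere, "surgeries … are performed in the interior and affect neither the boundary of
`M` nor its framing", A. Kosinski, *Differential Manifolds* (1993), p. 201).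

`SphereFamilySurgery.lean` renders Milnor's surgery `χ(V, φ₁, …, φ_k)` along a finite framed
family of disjoint spheres `φᵢ : Sᵏ × ℝˡ⁺¹ ↪ X` (*Lectures on the h-cobordism theorem* (1965),
Def. 3.11 and §3 p. 21) as a **relational** predicate `FramedSphereFamily.IsSurgery ν IP P`
(`P` is an open gluing of `X ∖ cores` and `ι × OD^{k+1} × Sˡ` along Milnor's identification
`φᵢ(u, θv) ∼ (θu, v)`), leaving existence aside.  This file **constructs** the surgered manifold
for a framed family in a (compact) smooth manifold `X` **with boundary** — `X` charted on the
half-space `EuclideanHalfSpace (n + 1)`, model `𝓡∂ (n + 1)`, `k + l = n` — exactly parallel to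
the one-circle boundaryless cases `CircleSurgeryExistence.lean` (type `(2, 3)` in a `4`-manifold)
and `TubeSurgery.lean` (Dehn surgery in a `3`-manifold), whose layout is ported line by line:

* `SphereSurgery.polar : Sᵏ × ℝˡ⁺¹ → ℝᵏ⁺¹ × Sˡ`, `(u, w) ↦ (‖w‖ • u, w/‖w‖)`, and
  `SphereSurgery.polarInv`, smooth off the zero section / the core;
* the new piece `ι × OD^{k+1} × Sˡ` (`Literature.Topology.FourManifolds.ballTimesSphere`, charted
  on a product of Euclidean models) re-charted on `ℝⁿ⁺¹` (`Literature.Geometry.Manifold.Rechart`,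
  `ModelChange.lean`) and then on the half-space (`HalfSpaceCharted`, `ClosedAsCobordism.lean`):
  `SphereSurgery.Handle ι k l hkl` (`hkl : k + l = n`), with the identity `SphereSurgery.toHandle`
  a smooth embedding (`HalfSpaceCharted.isSmoothEmbedding_of_into`,
  `HalfSpaceChartedEmbedding.lean`) and inverse `SphereSurgery.ofHandle`;
* for a framed family `ν` in an `ℍⁿ⁺¹`-charted `X`: the tubes lie in the interior of `X`
  (`FramedSphereFamily.isInteriorPoint_apply`: in the charts of the equidimensional immersion
  `φᵢ` at a point, `φᵢ` is a linear isomorphism onto an *open* subset of `ℝⁿ⁺¹` inside the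
  half-space, and charts of the maximal atlas detect interior points), so
  `∂X ⊆ X ∖ cores` (`FramedSphereFamily.boundary_subset_complement`);
* the gluing maps `FramedSphereFamily.fwdX/bwdX/fwdB/bwdA` and the gluing datum
  `ν.glueData hkl : SmoothGlueData (𝓡∂ (n + 1)) (𝓡∂ (n + 1)) (X ∖ cores) (Handle ι k l hkl) ℝⁿ⁺¹`
  along `φᵢ(u, w) ↦ (i, ‖w‖ • u, w/‖w‖)`, `0 < ‖w‖ < 1` (`ν.glue hkl`), realising Milnor's
  relation (`ν.sphereFamilySurgeryRel_iff`); the surgered manifold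
  `ν.Surgered hkl := (ν.glueData hkl).Glued` with its `C^∞` structure with boundary
  (`GluingConstructionBoundary.lean`): Hausdorff (`ν.isClosed_graph`: the graph of the gluing map
  is the trace of the compact set `ι × Sᵏ × [0, 1] × Sˡ`), compact for compact `X` (cover by
  `X ∖ ⋃ᵢ φᵢ(Sᵏ × ½Bˡ⁺¹)` and `ι × ½D^{k+1} × Sˡ`), second countable;
* `ν.isSurgery_surgered hkl : ν.IsSurgery (𝓡∂ (n + 1)) (ν.Surgered hkl)` with the explicit
  witnesses `inl` and `inr ∘ toHandle` (`ν.isOpenGluingWith_surgered`);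
* the boundary: `∂(ν.Surgered hkl) = inl(∂X)` (`ν.boundary_surgered_eq`); consequently a
  null-cobordism `M = ∂W` (`c : NullCobordism n M`) and a framed family `ν` in `W` yield the
  null-cobordism `M = ∂χ(W, ν)` (`NullCobordism.surgery c ν hkl`, `NullCobordism.isSurgery_surgery`,
  `NullCobordism.isOpenGluingWith_surgery`): surgery in the interior does not change the boundary
  (Kosinski 1993, X.2, p. 201; Kervaire–Milnor 1963, §5, spherical modifications of `(M, bM)`).

The index type `ι` is finite and **nonempty** (for an empty family the surgered manifold is `X`
itself and no gluing datum is needed); `X` and `ι` live in one universe `u`, so that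
`ν.Surgered hkl : Type u` can serve as the total space of a `NullCobordism` of an `M : Type u`.

Everything is proved; the definitions are constructions with bodies; no named facts.

## References

* J. Milnor, *Lectures on the h-cobordism theorem* (1965), Def. 3.11 (PDF p. 17), §3 p. 21.
  [MilnorHCobordism1965]
* A. Kosinski, *Differential Manifolds* (1993), VI.1–2 (gluing), X.2 (p. 201). [Kosinski1993]
* M. Kervaire, J. Milnor, *Groups of homotopy spheres I*, Ann. of Math. 77 (1963), §5
  (spherical modifications of manifolds with boundary). [KervaireMilnorAnnals1963]
-/

open scoped Manifold ContDiff Topology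
open Set Function Metric

noncomputable section

namespace Literature.Topology.FourManifolds

universe u

/-- Local notation: `𝔼 n` is the model Euclidean space `EuclideanSpace ℝ (Fin n)`. -/
local notation "𝔼 " n:arg => EuclideanSpace ℝ (Fin n)
/-- Local notation: `ℍ n` is the model half-space `EuclideanHalfSpace n`. -/
local notation "ℍ " n:arg => EuclideanHalfSpace n
/-- Local notation: `𝕊 n` is the unit sphere in `EuclideanSpace ℝ (Fin (n + 1))`. -/
local notation "𝕊 " n:arg => (Metric.sphere (0 : EuclideanSpace ℝ (Fin (n + 1))) 1)

attribute [local instance] fact_finrank_euclideanSpace_succ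

namespace SphereSurgery

/-! ### The polar maps `Sᵏ × ℝˡ⁺¹ ⇄ ℝᵏ⁺¹ × Sˡ` -/

variable {k l : ℕ}

/-- The **polar map** `(u, w) ↦ (‖w‖ • u, w / ‖w‖) : Sᵏ × ℝˡ⁺¹ → ℝᵏ⁺¹ × Sˡ` (junk second
component at `w = 0`), the coordinate change of Milnor's surgery identification
`φ(u, θv) ∼ (θu, v)`: it exchanges the core direction `u` and the fibre direction `w / ‖w‖`,
keeping the radius. [cite: MilnorHCobordism1965, Def. 3.11 (PDF p. 17)] -/
def polar (q : (𝕊 k) × (𝔼 (l + 1))) : (𝔼 (k + 1)) × (𝕊 l) :=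
  (‖q.2‖ • (q.1 : 𝔼 (k + 1)), radialProjection (spherePt l) q.2)

/-- The **inverse polar map** `(y, v) ↦ (y / ‖y‖, ‖y‖ • v) : ℝᵏ⁺¹ × Sˡ → Sᵏ × ℝˡ⁺¹` (junk first
component at `y = 0`). [cite: MilnorHCobordism1965, Def. 3.11 (PDF p. 17)] -/
def polarInv (p : (𝔼 (k + 1)) × (𝕊 l)) : (𝕊 k) × (𝔼 (l + 1)) :=
  (radialProjection (spherePt k) p.1, ‖p.1‖ • (p.2 : 𝔼 (l + 1)))

/-- `polarInv ∘ polar = id` off the zero section. [folklore] -/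
theorem polarInv_polar {q : (𝕊 k) × (𝔼 (l + 1))} (hq : q.2 ≠ 0) : polarInv (polar q) = q := by
  obtain ⟨u, w⟩ := q
  simp only [polar, polarInv] at hq ⊢
  rw [radialProjection_smul _ (norm_pos_iff.2 hq), norm_smul_coe_sphere (norm_nonneg _),
    norm_smul_coe_radialProjection]

/-- `polar ∘ polarInv = id` off the core `{0} × Sˡ`. [folklore] -/
theorem polar_polarInv {p : (𝔼 (k + 1)) × (𝕊 l)} (hp : p.1 ≠ 0) : polar (polarInv p) = p := by
  obtain ⟨y, v⟩ := p
  simp only [polar, polarInv] at hp ⊢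
  rw [norm_smul_coe_sphere (norm_nonneg _), norm_smul_coe_radialProjection,
    radialProjection_smul _ (norm_pos_iff.2 hp)]

/-- The disc coordinate of `polar (u, w)` has norm `‖w‖`. [folklore] -/
@[simp] theorem norm_polar_fst (q : (𝕊 k) × (𝔼 (l + 1))) : ‖(polar q).1‖ = ‖q.2‖ := by
  simp [polar, norm_smul_coe_sphere (norm_nonneg _)]

/-- `polarInv` of a point off the core is off the zero section. [folklore] -/
theorem polarInv_snd_ne_zero {p : (𝔼 (k + 1)) × (𝕊 l)} (hp : p.1 ≠ 0) : (polarInv p).2 ≠ 0 := by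
  simp only [polarInv, ne_eq, smul_eq_zero, norm_eq_zero, hp, false_or]
  exact ne_zero_of_mem_unit_sphere p.2

/-- The fibre coordinate of `polarInv (y, v)` has norm `‖y‖`. [folklore] -/
@[simp] theorem norm_polarInv_snd (p : (𝔼 (k + 1)) × (𝕊 l)) : ‖(polarInv p).2‖ = ‖p.1‖ := by
  simp [polarInv, norm_smul_coe_sphere (norm_nonneg _)]

/-- `polar (u, θ • v) = (θ • u, v)` for `θ > 0` (Milnor's identification in the coordinates
`(u, θ, v)`). [cite: MilnorHCobordism1965, Def. 3.11 (PDF p. 17)] -/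
theorem polar_smul (u : 𝕊 k) {θ : ℝ} (hθ : 0 < θ) (v : 𝕊 l) :
    polar (u, θ • (v : 𝔼 (l + 1))) = (θ • (u : 𝔼 (k + 1)), v) := by
  simp only [polar, norm_smul_coe_sphere hθ.le, radialProjection_smul _ hθ]

/-- The polar map is smooth away from the zero section. [folklore] -/
theorem contMDiffOn_polar :
    ContMDiffOn ((𝓡 k).prod 𝓘(ℝ, 𝔼 (l + 1))) (𝓘(ℝ, 𝔼 (k + 1)).prod (𝓡 l)) ∞
      (polar : (𝕊 k) × (𝔼 (l + 1)) → (𝔼 (k + 1)) × (𝕊 l)) {q | q.2 ≠ 0} := by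
  refine ContMDiffOn.prodMk ?_ ?_
  · intro q hq
    have h1 : ContMDiffAt ((𝓡 k).prod 𝓘(ℝ, 𝔼 (l + 1))) 𝓘(ℝ, ℝ) ∞
        (fun q : (𝕊 k) × (𝔼 (l + 1)) ↦ ‖q.2‖) q :=
      (contDiffAt_norm ℝ hq).comp_contMDiffAt contMDiffAt_snd
    have h2 : ContMDiffAt ((𝓡 k).prod 𝓘(ℝ, 𝔼 (l + 1))) 𝓘(ℝ, 𝔼 (k + 1)) ∞
        (fun q : (𝕊 k) × (𝔼 (l + 1)) ↦ ((q.1 : 𝕊 k) : 𝔼 (k + 1))) q :=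
      (contMDiff_coe_sphere (E := 𝔼 (k + 1)) (n := k)).contMDiffAt.comp q contMDiffAt_fst
    exact ((contDiff_fst (E := ℝ) (F := 𝔼 (k + 1)).smul contDiff_snd).contDiffAt.comp_contMDiffAt
      (h1.prodMk_space h2)).contMDiffWithinAt
  · exact (contMDiffOn_radialProjection _).comp contMDiff_snd.contMDiffOn fun q hq ↦ hq

/-- The inverse polar map is smooth away from the core `y = 0`. [folklore] -/
theorem contMDiffOn_polarInv :
    ContMDiffOn (𝓘(ℝ, 𝔼 (k + 1)).prod (𝓡 l)) ((𝓡 k).prod 𝓘(ℝ, 𝔼 (l + 1))) ∞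
      (polarInv : (𝔼 (k + 1)) × (𝕊 l) → (𝕊 k) × (𝔼 (l + 1))) {p | p.1 ≠ 0} := by
  refine ContMDiffOn.prodMk ?_ ?_
  · exact (contMDiffOn_radialProjection _).comp contMDiff_fst.contMDiffOn fun p hp ↦ hp
  · intro p hp
    have h1 : ContMDiffAt (𝓘(ℝ, 𝔼 (k + 1)).prod (𝓡 l)) 𝓘(ℝ, ℝ) ∞
        (fun p : (𝔼 (k + 1)) × (𝕊 l) ↦ ‖p.1‖) p :=
      (contDiffAt_norm ℝ hp).comp_contMDiffAt contMDiffAt_fst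
    have h2 : ContMDiffAt (𝓘(ℝ, 𝔼 (k + 1)).prod (𝓡 l)) 𝓘(ℝ, 𝔼 (l + 1)) ∞
        (fun p : (𝔼 (k + 1)) × (𝕊 l) ↦ ((p.2 : 𝕊 l) : 𝔼 (l + 1))) p :=
      (contMDiff_coe_sphere (E := 𝔼 (l + 1)) (n := l)).contMDiffAt.comp p contMDiffAt_snd
    exact ((contDiff_fst (E := ℝ) (F := 𝔼 (l + 1)).smul contDiff_snd).contDiffAt.comp_contMDiffAt
      (h1.prodMk_space h2)).contMDiffWithinAt

/-- The polar map is continuous away from the zero section. [folklore] -/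
theorem continuousOn_polar :
    ContinuousOn (polar : (𝕊 k) × (𝔼 (l + 1)) → (𝔼 (k + 1)) × (𝕊 l)) {q | q.2 ≠ 0} :=
  contMDiffOn_polar.continuousOn

/-- The inverse polar map is continuous away from the core. [folklore] -/
theorem continuousOn_polarInv :
    ContinuousOn (polarInv : (𝔼 (k + 1)) × (𝕊 l) → (𝕊 k) × (𝔼 (l + 1))) {p | p.1 ≠ 0} :=
  contMDiffOn_polarInv.continuousOn

/-! ### The new piece `ι × OD^{k+1} × Sˡ`, re-charted on the half-space `ℍⁿ⁺¹` -/

variable (ι : Type u) (k l)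

/-- The model vector space `ℝ⁰ × (ℝᵏ⁺¹ × ℝˡ)` of the product manifold
`DiscreteIndex ι × (ℝᵏ⁺¹ × Sˡ)` carrying the new piece. [folklore] -/
abbrev HandleModel : Type := (𝔼 0) × ((𝔼 (k + 1)) × (𝔼 l))

/-- The model with corners of the new piece: the product of the Euclidean self-models
(boundaryless). [folklore] -/
abbrev handleModelWithCorners :
    ModelWithCorners ℝ (HandleModel k l) (ModelProd (𝔼 0) (ModelProd (𝔼 (k + 1)) (𝔼 l))) :=
  (𝓡 0).prod ((𝓡 (k + 1)).prod (𝓡 l))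

variable {k l} {n : ℕ}

/-- The dimension count `0 + (k + 1) + l = n + 1` for `k + l = n`. [folklore] -/
theorem finrank_handleModel (hkl : k + l = n) :
    Module.finrank ℝ (HandleModel k l) = Module.finrank ℝ (𝔼 (n + 1)) := by
  simp only [Module.finrank_prod, finrank_euclideanSpace, Fintype.card_fin]
  omega

/-- A linear identification `ℝ⁰ × (ℝᵏ⁺¹ × ℝˡ) ≃L ℝⁿ⁺¹` (`k + l = n`). [folklore] -/
def handleLin (hkl : k + l = n) : HandleModel k l ≃L[ℝ] 𝔼 (n + 1) :=
  ContinuousLinearEquiv.ofFinrankEq (finrank_handleModel hkl)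

/-- The change of model space `ℝ⁰ × (ℝᵏ⁺¹ × ℝˡ) ≃ₜ ℝⁿ⁺¹` underlying `handleLin` (the model space
of a product of self-models is the product vector space). [folklore] -/
def handleHomeo (hkl : k + l = n) : ModelProd (𝔼 0) (ModelProd (𝔼 (k + 1)) (𝔼 l)) ≃ₜ 𝔼 (n + 1) :=
  (handleLin hkl).toHomeomorph

/-- `handleHomeo = handleLin ∘ I` for the product model with corners `I` (which is the identity
of the product vector space). [folklore] -/
theorem handleHomeo_apply (hkl : k + l = n) (x : ModelProd (𝔼 0) (ModelProd (𝔼 (k + 1)) (𝔼 l))) :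
    handleHomeo hkl x = handleLin hkl (handleModelWithCorners k l x) := by
  rfl

end SphereSurgery

/-! ### The handle piece `ι × OD^{k+1} × Sˡ` re-charted on the half-space -/

namespace SphereSurgery

open Literature.Geometry.Manifold

variable (ι : Type u) (k l : ℕ) {n : ℕ}

/-- **The new piece `ι × OD^{k+1} × Sˡ` re-charted on `ℝⁿ⁺¹`** (`k + l = n`): the type synonym
`Rechart (handleHomeo hkl)` of `↥(ballTimesSphere ι k l)` carrying the product atlas followed by
the linear change of model `ℝ⁰ × (ℝᵏ⁺¹ × ℝˡ) ≃ ℝⁿ⁺¹` (`ModelChange.lean`). [folklore] -/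
abbrev HandleE (hkl : k + l = n) : Type u :=
  Rechart (SphereSurgery.handleHomeo hkl) ↥(ballTimesSphere ι k l)

/-- The re-charted new piece is a `C^∞` manifold modelled on `ℝⁿ⁺¹` (`Rechart.isManifold`).
[folklore] -/
instance instIsManifoldHandleE (hkl : k + l = n) : IsManifold (𝓡 (n + 1)) ∞ (HandleE ι k l hkl) :=
  Rechart.isManifold (n := ∞) _ _
    (Rechart.contMDiff_of_apply_eq_linear _ (SphereSurgery.handleLin hkl)
      (SphereSurgery.handleHomeo_apply hkl))
    (Rechart.contMDiff_symm_of_apply_eq_linear _ (SphereSurgery.handleLin hkl)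
      (SphereSurgery.handleHomeo_apply hkl))

/-- **The handle piece**: the new piece `ι × OD^{k+1} × Sˡ` re-charted on the closed half-space
`ℍⁿ⁺¹` (`HalfSpaceCharted`, a manifold "with boundary" whose boundary is empty), ready to be
glued to `X ∖ cores` by `GluingConstructionBoundary.lean`. [folklore] -/
abbrev Handle (hkl : k + l = n) : Type u := HalfSpaceCharted (HandleE ι k l hkl)

/-- The identity `ι × OD^{k+1} × Sˡ → Handle`. [folklore] -/
def toHandle (hkl : k + l = n) : ↥(ballTimesSphere ι k l) → Handle ι k l hkl :=
  HalfSpaceCharted.of ∘ Rechart.into (SphereSurgery.handleHomeo hkl) ↥(ballTimesSphere ι k l)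

/-- The identity `Handle → ι × OD^{k+1} × Sˡ`. [folklore] -/
def ofHandle (hkl : k + l = n) : Handle ι k l hkl → ↥(ballTimesSphere ι k l) :=
  Rechart.out (SphereSurgery.handleHomeo hkl) ↥(ballTimesSphere ι k l) ∘ HalfSpaceCharted.of.symm

variable {ι k l}

/-- `ofHandle ∘ toHandle = id` (definitional). [folklore] -/
@[simp] theorem ofHandle_toHandle (hkl : k + l = n) (b : ↥(ballTimesSphere ι k l)) :
    ofHandle ι k l hkl (toHandle ι k l hkl b) = b := rfl

/-- `toHandle ∘ ofHandle = id` (definitional). [folklore] -/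
@[simp] theorem toHandle_ofHandle (hkl : k + l = n) (b : Handle ι k l hkl) :
    toHandle ι k l hkl (ofHandle ι k l hkl b) = b := rfl

/-- `toHandle` is a bijection. [folklore] -/
theorem bijective_toHandle (hkl : k + l = n) : Bijective (toHandle ι k l hkl) :=
  ⟨fun _ _ h ↦ by simpa using congrArg (ofHandle ι k l hkl) h,
    fun b ↦ ⟨ofHandle ι k l hkl b, rfl⟩⟩

/-- **`toHandle` is a `C^∞` embedding** (product model to `𝓡∂ (n + 1)`;
`HalfSpaceCharted.isSmoothEmbedding_of_into`). [folklore] -/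
theorem isSmoothEmbedding_toHandle (hkl : k + l = n) :
    Manifold.IsSmoothEmbedding (SphereSurgery.handleModelWithCorners k l) (𝓡∂ (n + 1)) ∞
      (toHandle ι k l hkl) :=
  HalfSpaceCharted.isSmoothEmbedding_of_into (SphereSurgery.handleHomeo hkl)
    (SphereSurgery.handleLin hkl) (SphereSurgery.handleHomeo_apply hkl)

/-- `toHandle` is `C^∞`. [folklore] -/
theorem contMDiff_toHandle (hkl : k + l = n) :
    ContMDiff (SphereSurgery.handleModelWithCorners k l) (𝓡∂ (n + 1)) ∞ (toHandle ι k l hkl) :=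
  (isSmoothEmbedding_toHandle hkl).contMDiff

/-- `ofHandle` is `C^∞`. [folklore] -/
theorem contMDiff_ofHandle (hkl : k + l = n) :
    ContMDiff (𝓡∂ (n + 1)) (SphereSurgery.handleModelWithCorners k l) ∞ (ofHandle ι k l hkl) :=
  HalfSpaceCharted.contMDiff_out_of_symm (SphereSurgery.handleHomeo hkl)
    (SphereSurgery.handleLin hkl) (SphereSurgery.handleHomeo_apply hkl)

/-- `toHandle` is continuous. [folklore] -/
theorem continuous_toHandle (hkl : k + l = n) : Continuous (toHandle ι k l hkl) :=
  (contMDiff_toHandle hkl).continuous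

/-- `ofHandle` is continuous. [folklore] -/
theorem continuous_ofHandle (hkl : k + l = n) : Continuous (ofHandle ι k l hkl) :=
  (contMDiff_ofHandle hkl).continuous

/-- `toHandle` is an open embedding (a homeomorphism). [folklore] -/
theorem isOpenEmbedding_toHandle (hkl : k + l = n) :
    Topology.IsOpenEmbedding (toHandle ι k l hkl) :=
  HalfSpaceCharted.isOpenEmbedding_of_into (SphereSurgery.handleHomeo hkl)

/-- `toHandle` is onto. [folklore] -/
@[simp] theorem range_toHandle (hkl : k + l = n) : range (toHandle ι k l hkl) = univ :=
  (bijective_toHandle hkl).2.range_eq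

/-- The handle piece has no boundary points. [folklore] -/
theorem not_isBoundaryPoint_handle (hkl : k + l = n) (b : Handle ι k l hkl) :
    ¬ (𝓡∂ (n + 1)).IsBoundaryPoint b := by
  intro h
  have : b ∈ (𝓡∂ (n + 1)).boundary (Handle ι k l hkl) := h
  rw [HalfSpaceCharted.boundary_eq_empty] at this
  exact this

/-- The compact piece `ι × ½D^{k+1} × Sˡ` of the handle (the image under `toHandle` of the points
with disc coordinate of norm `≤ ½`). [folklore] -/
def handleCpt (hkl : k + l = n) : Set (Handle ι k l hkl) :=
  toHandle ι k l hkl ''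
    {b : ↥(ballTimesSphere ι k l) | ‖(b : DiscreteIndex ι × ((𝔼 (k + 1)) × (𝕊 l))).2.1‖ ≤ 2⁻¹}

/-- `ι × ½D^{k+1} × Sˡ` is compact (for finite `ι`). [folklore] -/
theorem isCompact_handleCpt [Finite ι] (hkl : k + l = n) : IsCompact (handleCpt (ι := ι) hkl) := by
  refine IsCompact.image ?_ (continuous_toHandle hkl)
  have h : {b : ↥(ballTimesSphere ι k l) |
      ‖(b : DiscreteIndex ι × ((𝔼 (k + 1)) × (𝕊 l))).2.1‖ ≤ 2⁻¹} =
      ((↑) : ↥(ballTimesSphere ι k l) → DiscreteIndex ι × ((𝔼 (k + 1)) × (𝕊 l))) ⁻¹'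
        (univ ×ˢ (closedBall (0 : 𝔼 (k + 1)) 2⁻¹ ×ˢ univ)) := by
    ext b; simp
  rw [h]
  refine Topology.IsInducing.subtypeVal.isCompact_preimage'
    (isCompact_univ.prod ((isCompact_closedBall _ _).prod isCompact_univ)) ?_
  rintro ⟨j, y, v⟩ ⟨-, hy, -⟩
  rw [mem_closedBall, dist_zero_right] at hy
  have hb : ((j, y, v) : DiscreteIndex ι × ((𝔼 (k + 1)) × (𝕊 l))) ∈ ballTimesSphere ι k l := by
    rw [mem_ballTimesSphere_iff]; exact hy.trans_lt (by norm_num)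
  exact ⟨⟨(j, y, v), hb⟩, rfl⟩

end SphereSurgery

/-! ### Framed families in a manifold with boundary: the tubes lie in the interior -/

namespace FramedSphereFamily

variable {n k l : ℕ} {X : Type u} [TopologicalSpace X] [ChartedSpace (ℍ (n + 1)) X]
  {ι : Type u} (ν : FramedSphereFamily (𝓡∂ (n + 1)) X ι k (l + 1))

/-- Each tube of a framed family is an open embedding. [folklore] -/
protected theorem isOpenEmbedding (i : ι) : Topology.IsOpenEmbedding (ν.toFun i) :=
  ⟨(ν.isSmoothEmbedding i).isEmbedding, ν.isOpen_range i⟩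

/-- `φᵢ (u, w)` lies on the cores iff `w = 0`. [folklore] -/
theorem apply_mem_cores_iff [T2Space X] [Finite ι] (i : ι) {u : 𝕊 k} {w : 𝔼 (l + 1)} :
    ν.toFun i (u, w) ∈ ν.cores ↔ w = 0 := by
  constructor
  · intro h
    by_contra hw
    exact ν.apply_mem_complement i u hw h
  · rintro rfl
    exact ν.sphere_mem_cores i u

/-- **The tubes of a framed family lie in the interior** of the manifold with boundary `X`
(`k + l = n`): in the charts of the immersion `φᵢ` at `q`, `φᵢ` reads as an injective linear map
`ℝᵏ × ℝˡ⁺¹ → ℝⁿ⁺¹`, an isomorphism by the dimension count, so the codomain chart maps a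
neighbourhood of `φᵢ q` onto an *open* subset of `ℝⁿ⁺¹` contained in the half-space, hence into
its interior; and charts of the maximal atlas detect interior points (Mathlib's
`MDifferentiableAt.isInteriorPoint_of_surjective_mfderiv`). Kosinski 1993, X.2, p. 201:
"surgeries … are performed in the interior". [cite: Kosinski1993, Ch. X §2, p. 201] -/
theorem isInteriorPoint_apply [IsManifold (𝓡∂ (n + 1)) ∞ X] (hkl : k + l = n) (i : ι)
    (q : (𝕊 k) × (𝔼 (l + 1))) : (𝓡∂ (n + 1)).IsInteriorPoint (ν.toFun i q) := by
  have hf : Manifold.IsImmersionAt ((𝓡 k).prod 𝓘(ℝ, 𝔼 (l + 1))) (𝓡∂ (n + 1)) ∞ (ν.toFun i) q :=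
    (ν.isSmoothEmbedding i).isImmersion.isImmersionAt q
  -- the linear model `u ↦ equiv (u, 0)` is a linear isomorphism, hence an open map
  let L : (𝔼 k × 𝔼 (l + 1)) →ₗ[ℝ] 𝔼 (n + 1) :=
    hf.equiv.toLinearEquiv.toLinearMap ∘ₗ LinearMap.inl ℝ (𝔼 k × 𝔼 (l + 1)) hf.complement
  have hL_apply : ∀ u, L u = hf.equiv (u, 0) := fun u ↦ rfl
  have hL_inj : Injective L := hf.equiv.injective.comp (Prod.mk_left_injective 0)
  have hE : Module.finrank ℝ (𝔼 k × 𝔼 (l + 1)) = Module.finrank ℝ (𝔼 (n + 1)) := by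
    simp only [Module.finrank_prod, finrank_euclideanSpace, Fintype.card_fin]
    omega
  have hL_open : IsOpenMap L := L.isOpenMap_of_finiteDimensional
    ((LinearMap.injective_iff_surjective_of_finrank_eq_finrank hE).1 hL_inj)
  set φ := hf.domChart
  set ψ := hf.codChart
  have hqφ : q ∈ φ.source := hf.mem_domChart_source
  -- `ψ (φᵢ q)` lies in the open subset `L '' φ.extend.target` of `ℝⁿ⁺¹`, inside the half-space
  have hsub : L '' (φ.extend ((𝓡 k).prod 𝓘(ℝ, 𝔼 (l + 1)))).target ⊆ range (𝓡∂ (n + 1)) := by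
    rintro _ ⟨u, hu, rfl⟩
    have h := hf.writtenInCharts hu
    simp only [comp_apply] at h
    rw [hL_apply, ← h, OpenPartialHomeomorph.extend_coe]
    exact mem_range_self _
  have hmem : ψ.extend (𝓡∂ (n + 1)) (ν.toFun i q) ∈
      L '' (φ.extend ((𝓡 k).prod 𝓘(ℝ, 𝔼 (l + 1)))).target := by
    have hu : φ.extend ((𝓡 k).prod 𝓘(ℝ, 𝔼 (l + 1))) q ∈
        (φ.extend ((𝓡 k).prod 𝓘(ℝ, 𝔼 (l + 1)))).target :=
      (φ.extend _).map_source (by rwa [OpenPartialHomeomorph.extend_source])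
    refine ⟨_, hu, ?_⟩
    have h := hf.writtenInCharts hu
    simp only [comp_apply] at h
    rw [hL_apply, ← h, (φ.extend _).left_inv (by rwa [OpenPartialHomeomorph.extend_source])]
  have hint : ψ.extend (𝓡∂ (n + 1)) (ν.toFun i q) ∈ interior (range (𝓡∂ (n + 1))) :=
    interior_maximal hsub (hL_open _ (φ.isOpen_extend_target (I := (𝓡 k).prod 𝓘(ℝ, 𝔼 (l + 1)))))
      hmem
  -- charts of the maximal atlas detect interior points
  have hψ : ψ ∈ IsManifold.maximalAtlas (𝓡∂ (n + 1)) ∞ X := hf.codChart_mem_maximalAtlas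
  have hx : ν.toFun i q ∈ ψ.source := hf.mem_codChart_source
  have hy : (𝓡∂ (n + 1)).IsInteriorPoint (ψ (ν.toFun i q)) := by
    simp only [ModelWithCorners.IsInteriorPoint, extChartAt_self_apply]
    simpa [ψ.extend_coe] using hint
  have hd : MDifferentiableAt (𝓡∂ (n + 1)) (𝓡∂ (n + 1)) ψ.symm (ψ (ν.toFun i q)) :=
    (contMDiffAt_symm_of_mem_maximalAtlas hψ (ψ.map_source hx)).mdifferentiableAt (by simp)
  have hs : Surjective (mfderiv (𝓡∂ (n + 1)) (𝓡∂ (n + 1)) ψ.symm (ψ (ν.toFun i q))) :=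
    (OpenPartialHomeomorph.MDifferentiable.symm
      ⟨(contMDiffOn_of_mem_maximalAtlas hψ).mdifferentiableOn (by simp),
        (contMDiffOn_symm_of_mem_maximalAtlas hψ).mdifferentiableOn (by simp)⟩).mfderiv_surjective
      (ψ.map_source hx)
  have := hd.isInteriorPoint_of_surjective_mfderiv hs hy
  rwa [ψ.left_inv hx] at this

/-- The tubes of a framed family miss the boundary of `X` (`k + l = n`).
[cite: Kosinski1993, Ch. X §2, p. 201] -/
theorem apply_not_mem_boundary [IsManifold (𝓡∂ (n + 1)) ∞ X] (hkl : k + l = n) (i : ι)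
    (q : (𝕊 k) × (𝔼 (l + 1))) : ν.toFun i q ∉ (𝓡∂ (n + 1)).boundary X := fun h ↦
  ((𝓡∂ (n + 1)).isInteriorPoint_iff_not_isBoundaryPoint _).1 (ν.isInteriorPoint_apply hkl i q) h

/-- **The boundary of `X` lies in the complement of the cores** (`k + l = n`).
[cite: Kosinski1993, Ch. X §2, p. 201] -/
theorem boundary_subset_complement [T2Space X] [Finite ι] [IsManifold (𝓡∂ (n + 1)) ∞ X]
    (hkl : k + l = n) : (𝓡∂ (n + 1)).boundary X ⊆ (ν.complement : Set X) := by
  intro x hx hx'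
  obtain ⟨i, v, rfl⟩ := ν.mem_cores_iff.1 hx'
  exact ν.apply_not_mem_boundary hkl i (v, 0) hx


/-! ### The gluing maps of a framed family -/

section Maps

/-- The index of the tube containing `x` (junk value off the tubes). [folklore] -/
def tubeIndex [Nonempty ι] (x : X) : ι := by
  classical
  exact if h : ∃ i, x ∈ range (ν.toFun i) then h.choose else Classical.arbitrary ι

/-- The tube index of a point of the `i`-th tube is `i` (the tubes are disjoint). [folklore] -/
theorem tubeIndex_apply [Nonempty ι] (i : ι) (q : (𝕊 k) × (𝔼 (l + 1))) :
    ν.tubeIndex (ν.toFun i q) = i := by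
  classical
  have h : ∃ j, ν.toFun i q ∈ range (ν.toFun j) := ⟨i, q, rfl⟩
  rw [tubeIndex, dif_pos h]
  by_contra hne
  obtain ⟨q', hq'⟩ := h.choose_spec
  exact ν.apply_ne_apply hne q' q hq'

/-- The `i`-th tube as an open partial homeomorphism `Sᵏ × ℝˡ⁺¹ ⇀ X` (source `univ`, target its
range). [folklore] -/
def toHomeo (i : ι) : OpenPartialHomeomorph ((𝕊 k) × (𝔼 (l + 1))) X :=
  (ν.isOpenEmbedding i).toOpenPartialHomeomorph _

/-- The partial homeomorphism of the `i`-th tube is `φᵢ` as a function. [folklore] -/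
@[simp] theorem toHomeo_apply (i : ι) (q : (𝕊 k) × (𝔼 (l + 1))) : ν.toHomeo i q = ν.toFun i q :=
  rfl

/-- The partial homeomorphism of a tube is defined everywhere. [folklore] -/
@[simp] theorem toHomeo_source (i : ι) : (ν.toHomeo i).source = univ := by simp [toHomeo]

/-- The target of the partial homeomorphism of a tube is the (open) range of the tube. [folklore] -/
@[simp] theorem toHomeo_target (i : ι) : (ν.toHomeo i).target = range (ν.toFun i) := by
  simp [toHomeo]

/-- The inverse of the partial homeomorphism of a tube is a left inverse of the tube. [folklore] -/
@[simp] theorem toHomeo_symm_apply (i : ι) (q : (𝕊 k) × (𝔼 (l + 1))) :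
    (ν.toHomeo i).symm (ν.toFun i q) = q :=
  (ν.isOpenEmbedding i).toOpenPartialHomeomorph_left_inv

/-- **The inverse of a tube is smooth on its range** (`contMDiffOn_symm_of_isSmoothEmbedding`).
[folklore] -/
theorem contMDiffOn_toHomeo_symm (i : ι) :
    ContMDiffOn (𝓡∂ (n + 1)) ((𝓡 k).prod 𝓘(ℝ, 𝔼 (l + 1))) ∞ (ν.toHomeo i).symm
      (range (ν.toFun i)) :=
  contMDiffOn_symm_of_isSmoothEmbedding (ν.isSmoothEmbedding i) (ν.isOpenEmbedding i)

/-- The **punctured open tube** `φᵢ(Sᵏ × (Bˡ⁺¹ ∖ 0))` of the `i`-th sphere, the part of the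
gluing region in the `i`-th tube. [folklore] -/
def puncturedTube (i : ι) : Set X := ν.toFun i '' {q | q.2 ≠ 0 ∧ ‖q.2‖ < 1}

/-- The punctured tubes are open. [folklore] -/
theorem isOpen_puncturedTube (i : ι) : IsOpen (ν.puncturedTube i) := by
  refine (ν.isOpenEmbedding i).isOpenMap _ (IsOpen.inter ?_ ?_)
  · exact isOpen_ne.preimage continuous_snd
  · exact isOpen_lt (continuous_norm.comp continuous_snd) continuous_const

/-- `φⱼ q` lies in the `i`-th punctured tube iff `j = i` and `0 < ‖q.2‖ < 1`. [folklore] -/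
theorem apply_mem_puncturedTube_iff {i j : ι} {q : (𝕊 k) × (𝔼 (l + 1))} :
    ν.toFun j q ∈ ν.puncturedTube i ↔ j = i ∧ q.2 ≠ 0 ∧ ‖q.2‖ < 1 := by
  constructor
  · rintro ⟨q', hq', h⟩
    by_cases hji : j = i
    · subst hji
      obtain rfl := ν.injective j h
      exact ⟨rfl, hq'⟩
    · exact (ν.apply_ne_apply (Ne.symm hji) q' q h).elim
  · rintro ⟨rfl, hq⟩
    exact ⟨q, hq, rfl⟩

/-- The **gluing region** `⋃ᵢ φᵢ(Sᵏ × (Bˡ⁺¹ ∖ 0))` on the side of `X`. [folklore] -/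
def puncturedTubes : Set X := ⋃ i, ν.puncturedTube i

/-- The gluing region is open. [folklore] -/
theorem isOpen_puncturedTubes : IsOpen ν.puncturedTubes :=
  isOpen_iUnion fun i ↦ ν.isOpen_puncturedTube i

/-- Membership in the gluing region. [folklore] -/
theorem mem_puncturedTubes_iff {x : X} :
    x ∈ ν.puncturedTubes ↔
      ∃ i q, (q : (𝕊 k) × (𝔼 (l + 1))).2 ≠ 0 ∧ ‖q.2‖ < 1 ∧ ν.toFun i q = x := by
  simp only [puncturedTubes, mem_iUnion, puncturedTube, mem_image, mem_setOf_eq]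
  constructor
  · rintro ⟨i, q, ⟨h0, h1⟩, rfl⟩; exact ⟨i, q, h0, h1, rfl⟩
  · rintro ⟨i, q, h0, h1, rfl⟩; exact ⟨i, q, ⟨h0, h1⟩, rfl⟩

/-- `φᵢ q` lies in the gluing region iff `0 < ‖q.2‖ < 1`. [folklore] -/
theorem apply_mem_puncturedTubes_iff {i : ι} {q : (𝕊 k) × (𝔼 (l + 1))} :
    ν.toFun i q ∈ ν.puncturedTubes ↔ q.2 ≠ 0 ∧ ‖q.2‖ < 1 := by
  simp only [puncturedTubes, mem_iUnion, apply_mem_puncturedTube_iff]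
  exact ⟨fun ⟨_, _, h⟩ ↦ h, fun h ↦ ⟨i, rfl, h⟩⟩

/-- The gluing region misses the cores. [folklore] -/
theorem puncturedTubes_subset_complement [T2Space X] [Finite ι] :
    ν.puncturedTubes ⊆ (ν.complement : Set X) := by
  intro x hx
  obtain ⟨i, ⟨u, w⟩, hw, -, rfl⟩ := ν.mem_puncturedTubes_iff.1 hx
  exact ν.apply_mem_complement i u hw

/-- The forward gluing map at the level of `X`: `φᵢ(u, w) ↦ (i, ‖w‖ • u, w / ‖w‖)` (junk off the
tubes). [cite: MilnorHCobordism1965, Def. 3.11 (PDF p. 17)] -/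
def fwdX [Nonempty ι] (x : X) : DiscreteIndex ι × ((𝔼 (k + 1)) × (𝕊 l)) :=
  (DiscreteIndex.mk (ν.tubeIndex x), SphereSurgery.polar ((ν.toHomeo (ν.tubeIndex x)).symm x))

/-- On the `i`-th tube the forward map is `(i, SphereSurgery.polar ∘ φᵢ⁻¹)`. [folklore] -/
theorem fwdX_apply [Nonempty ι] (i : ι) (q : (𝕊 k) × (𝔼 (l + 1))) :
    ν.fwdX (ν.toFun i q) = (DiscreteIndex.mk i, SphereSurgery.polar q) := by
  rw [fwdX, tubeIndex_apply, toHomeo_symm_apply]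

/-- **The forward gluing map is smooth on the gluing region.** [folklore] -/
theorem contMDiffOn_fwdX [Nonempty ι] :
    ContMDiffOn (𝓡∂ (n + 1)) (SphereSurgery.handleModelWithCorners k l) ∞ ν.fwdX
      ν.puncturedTubes := by
  intro x hx
  obtain ⟨i, q, hq0, -, rfl⟩ := ν.mem_puncturedTubes_iff.1 hx
  have hev : ν.fwdX =ᶠ[𝓝 (ν.toFun i q)]
      fun x ↦ (DiscreteIndex.mk i, SphereSurgery.polar ((ν.toHomeo i).symm x)) := by
    filter_upwards [(ν.isOpen_range i).mem_nhds (mem_range_self q)]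
    rintro _ ⟨q', rfl⟩
    rw [fwdX_apply, toHomeo_symm_apply]
  refine (ContMDiffAt.congr_of_eventuallyEq ?_ hev).contMDiffWithinAt
  refine ContMDiffAt.prodMk contMDiffAt_const ?_
  have h1 : ContMDiffAt (𝓡∂ (n + 1)) ((𝓡 k).prod 𝓘(ℝ, 𝔼 (l + 1))) ∞ (ν.toHomeo i).symm
      (ν.toFun i q) :=
    (ν.contMDiffOn_toHomeo_symm i).contMDiffAt ((ν.isOpen_range i).mem_nhds (mem_range_self q))
  have h2 : ContMDiffAt ((𝓡 k).prod 𝓘(ℝ, 𝔼 (l + 1))) (𝓘(ℝ, 𝔼 (k + 1)).prod (𝓡 l)) ∞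
      SphereSurgery.polar ((ν.toHomeo i).symm (ν.toFun i q)) := by
    rw [toHomeo_symm_apply]
    exact SphereSurgery.contMDiffOn_polar.contMDiffAt
      ((isOpen_ne.preimage continuous_snd).mem_nhds hq0)
  exact h2.comp _ h1

/-- The backward gluing map `(i, y, v) ↦ φᵢ (y / ‖y‖, ‖y‖ • v)`.
[cite: MilnorHCobordism1965, Def. 3.11 (PDF p. 17)] -/
def bwdX (p : DiscreteIndex ι × ((𝔼 (k + 1)) × (𝕊 l))) : X :=
  ν.toFun (DiscreteIndex.mk.symm p.1) (SphereSurgery.polarInv p.2)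

/-- Unfolding lemma for the backward map. [folklore] -/
theorem bwdX_apply (p : DiscreteIndex ι × ((𝔼 (k + 1)) × (𝕊 l))) :
    ν.bwdX p = ν.toFun (DiscreteIndex.mk.symm p.1) (SphereSurgery.polarInv p.2) := rfl

/-- **The backward gluing map is smooth off the cores of the new piece.** [folklore] -/
theorem contMDiffOn_bwdX :
    ContMDiffOn (SphereSurgery.handleModelWithCorners k l) (𝓡∂ (n + 1)) ∞ ν.bwdX
      {p | p.2.1 ≠ 0} := by
  rintro ⟨j, y, v⟩ hp
  have hev : ν.bwdX =ᶠ[𝓝 (j, y, v)]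
      fun p ↦ ν.toFun (DiscreteIndex.mk.symm j) (SphereSurgery.polarInv p.2) := by
    have ho : IsOpen (({j} : Set (DiscreteIndex ι)) ×ˢ (univ : Set ((𝔼 (k + 1)) × (𝕊 l)))) :=
      (isOpen_discrete _).prod isOpen_univ
    filter_upwards [ho.mem_nhds ⟨rfl, mem_univ _⟩]
    rintro ⟨j', p'⟩ ⟨hj', -⟩
    rw [mem_singleton_iff] at hj'
    subst hj'
    rfl
  refine (ContMDiffAt.congr_of_eventuallyEq ?_ hev).contMDiffWithinAt
  have h1 : ContMDiffAt (SphereSurgery.handleModelWithCorners k l) ((𝓡 k).prod 𝓘(ℝ, 𝔼 (l + 1))) ∞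
      (fun p : DiscreteIndex ι × ((𝔼 (k + 1)) × (𝕊 l)) ↦ SphereSurgery.polarInv p.2) (j, y, v) :=
    (SphereSurgery.contMDiffOn_polarInv.contMDiffAt
      ((isOpen_ne.preimage continuous_fst).mem_nhds hp)).comp _ contMDiffAt_snd
  exact (ν.contMDiff _).contMDiffAt.comp _ h1

/-- A base point of the new piece `ι × OD^{k+1} × Sˡ` (junk value). [folklore] -/
def basePtB [Nonempty ι] : ↥(ballTimesSphere ι k l) :=
  ⟨(DiscreteIndex.mk (Classical.arbitrary ι), ((0 : 𝔼 (k + 1)), spherePt l)), by simp⟩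

/-- A fixed nonzero vector of norm `1/2` in the fibre `ℝˡ⁺¹`. [folklore] -/
def halfVec : 𝔼 (l + 1) := (2 : ℝ)⁻¹ • EuclideanSpace.single 0 1

omit [ChartedSpace (ℍ (n + 1)) X] in
/-- `halfVec ≠ 0`. [folklore] -/
theorem halfVec_ne_zero : (halfVec : 𝔼 (l + 1)) ≠ 0 := by
  simp [halfVec]

/-- The forward gluing map `X → ι × OD^{k+1} × Sˡ` (values in the open piece; junk where
undefined). [folklore] -/
def fwdB [Nonempty ι] (x : X) : ↥(ballTimesSphere ι k l) := by
  classical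
  exact if h : ν.fwdX x ∈ ballTimesSphere ι k l then ⟨ν.fwdX x, h⟩ else basePtB

/-- The forward map sends `φᵢ (u, w)`, `‖w‖ < 1`, into the open piece. [folklore] -/
theorem fwdX_mem_ballTimesSphere [Nonempty ι] {i : ι} {q : (𝕊 k) × (𝔼 (l + 1))}
    (hq : ‖q.2‖ < 1) : ν.fwdX (ν.toFun i q) ∈ ballTimesSphere ι k l := by
  rw [fwdX_apply, mem_ballTimesSphere_iff, SphereSurgery.norm_polar_fst]; exact hq

/-- The forward map into the open piece on the tubes of radius `1` is `(i, polar)`. [folklore] -/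
theorem coe_fwdB_apply [Nonempty ι] {i : ι} {q : (𝕊 k) × (𝔼 (l + 1))} (hq : ‖q.2‖ < 1) :
    (ν.fwdB (ν.toFun i q) : DiscreteIndex ι × ((𝔼 (k + 1)) × (𝕊 l))) =
      (DiscreteIndex.mk i, SphereSurgery.polar q) := by
  classical
  rw [fwdB, dif_pos (ν.fwdX_mem_ballTimesSphere hq), Subtype.coe_mk, fwdX_apply]

variable [T2Space X] [Finite ι]

/-- A base point of `X ∖ cores` (junk value): `φ_{i₀} (e₀, w₀)` with `w₀ ≠ 0`. [folklore] -/
def basePtA [Nonempty ι] : ↥ν.complement :=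
  ⟨ν.toFun (Classical.arbitrary ι) (spherePt k, halfVec),
    ν.apply_mem_complement _ _ halfVec_ne_zero⟩

/-- The backward gluing map `ι × (ℝᵏ⁺¹ × Sˡ) → X ∖ cores` (junk where undefined). [folklore] -/
def bwdA [Nonempty ι] (p : DiscreteIndex ι × ((𝔼 (k + 1)) × (𝕊 l))) : ↥ν.complement := by
  classical
  exact if h : ν.bwdX p ∈ ν.complement then ⟨ν.bwdX p, h⟩ else ν.basePtA

/-- The backward map lands in the complement of the cores off the cores of the new piece.
[folklore] -/
theorem bwdX_mem_complement {p : DiscreteIndex ι × ((𝔼 (k + 1)) × (𝕊 l))} (hp : p.2.1 ≠ 0) :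
    ν.bwdX p ∈ ν.complement :=
  ν.apply_mem_complement _ _ (SphereSurgery.polarInv_snd_ne_zero hp)

/-- The backward map into `X ∖ cores` off the cores of the new piece is `φᵢ ∘ polarInv`.
[folklore] -/
theorem coe_bwdA_apply [Nonempty ι] {p : DiscreteIndex ι × ((𝔼 (k + 1)) × (𝕊 l))}
    (hp : p.2.1 ≠ 0) :
    (ν.bwdA p : X) = ν.toFun (DiscreteIndex.mk.symm p.1) (SphereSurgery.polarInv p.2) := by
  classical
  rw [bwdA, dif_pos (ν.bwdX_mem_complement hp)]
  rfl

/-- The forward gluing map is smooth on the gluing region, as a map from `X ∖ cores` into the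
open piece `ι × OD^{k+1} × Sˡ`. [folklore] -/
theorem contMDiffOn_fwdB [Nonempty ι] :
    ContMDiffOn (𝓡∂ (n + 1)) (SphereSurgery.handleModelWithCorners k l) ∞
      (fun a : ↥ν.complement ↦ ν.fwdB a) {a | (a : X) ∈ ν.puncturedTubes} := by
  intro a ha
  refine (contMDiffAt_subtype_iff.2 ?_).contMDiffWithinAt
  rw [← ContMDiffAt.subtypeVal_comp_iff]
  have hev : (Subtype.val ∘ fun y ↦ ν.fwdB y) =ᶠ[𝓝 (a : X)] ν.fwdX := by
    filter_upwards [ν.isOpen_puncturedTubes.mem_nhds ha] with x hx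
    obtain ⟨i, q, -, hq1, rfl⟩ := ν.mem_puncturedTubes_iff.1 hx
    simp only [Function.comp_apply]
    rw [ν.coe_fwdB_apply hq1, fwdX_apply]
  exact (ν.contMDiffOn_fwdX.contMDiffAt (ν.isOpen_puncturedTubes.mem_nhds ha)).congr_of_eventuallyEq
    hev

/-- The backward gluing map is smooth off the cores of the new piece, as a map into
`X ∖ cores`. [folklore] -/
theorem contMDiffOn_bwdA [Nonempty ι] :
    ContMDiffOn (SphereSurgery.handleModelWithCorners k l) (𝓡∂ (n + 1)) ∞
      (fun p : DiscreteIndex ι × ((𝔼 (k + 1)) × (𝕊 l)) ↦ ν.bwdA p) {p | p.2.1 ≠ 0} := by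
  intro p hp
  have ho : IsOpen {p : DiscreteIndex ι × ((𝔼 (k + 1)) × (𝕊 l)) | p.2.1 ≠ 0} :=
    isOpen_ne.preimage (continuous_fst.comp continuous_snd)
  refine ContMDiffAt.contMDiffWithinAt ?_
  rw [← ContMDiffAt.subtypeVal_comp_iff]
  have hev : (Subtype.val ∘ fun y ↦ ν.bwdA y) =ᶠ[𝓝 p] ν.bwdX := by
    filter_upwards [ho.mem_nhds hp] with p' hp'
    simp only [Function.comp_apply]
    rw [ν.coe_bwdA_apply hp']
    rfl
  exact (ν.contMDiffOn_bwdX.contMDiffAt (ho.mem_nhds hp)).congr_of_eventuallyEq hev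

end Maps


/-! ### The gluing datum and the surgered manifold -/

section Glue

variable [T2Space X] [Finite ι] [Nonempty ι] (hkl : k + l = n)

/-- **The gluing partial diffeomorphism of the surgery** along `ν`:
`φᵢ(u, w) ↦ (i, ‖w‖ • u, w / ‖w‖)` from the gluing region `⋃ᵢ φᵢ(Sᵏ × (Bˡ⁺¹ ∖ 0)) ⊆ X ∖ cores`
onto `ι × (OD^{k+1} ∖ 0) × Sˡ ⊆ Handle` (Milnor 1965, Def. 3.11: "identifying `φ(u, θv)` with
`(θu, v)`"). [cite: MilnorHCobordism1965, Def. 3.11 (PDF p. 17)] -/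
def glue : OpenPartialHomeomorph (↥ν.complement) (SphereSurgery.Handle ι k l hkl) where
  toFun a := SphereSurgery.toHandle ι k l hkl (ν.fwdB a)
  invFun b := ν.bwdA (SphereSurgery.ofHandle ι k l hkl b : DiscreteIndex ι × ((𝔼 (k + 1)) × (𝕊 l)))
  source := {a : ↥ν.complement | (a : X) ∈ ν.puncturedTubes}
  target := {b : SphereSurgery.Handle ι k l hkl |
    ((SphereSurgery.ofHandle ι k l hkl b : ↥(ballTimesSphere ι k l)) :
      DiscreteIndex ι × ((𝔼 (k + 1)) × (𝕊 l))).2.1 ≠ 0}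
  map_source' := by
    rintro ⟨x, hx'⟩ hx
    obtain ⟨i, q, hq0, hq1, rfl⟩ := ν.mem_puncturedTubes_iff.1 hx
    show ((ν.fwdB (ν.toFun i q) : ↥(ballTimesSphere ι k l)) :
      DiscreteIndex ι × ((𝔼 (k + 1)) × (𝕊 l))).2.1 ≠ 0
    rw [ν.coe_fwdB_apply hq1, ← norm_ne_zero_iff, SphereSurgery.norm_polar_fst, norm_ne_zero_iff]
    exact hq0
  map_target' := by
    intro b hb
    show (ν.bwdA _ : X) ∈ ν.puncturedTubes
    rw [ν.coe_bwdA_apply hb, apply_mem_puncturedTubes_iff, SphereSurgery.norm_polarInv_snd]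
    exact ⟨SphereSurgery.polarInv_snd_ne_zero hb,
      (mem_ballTimesSphere_iff _).1 (SphereSurgery.ofHandle ι k l hkl b).2⟩
  left_inv' := by
    rintro ⟨x, hx'⟩ hx
    obtain ⟨i, q, hq0, hq1, rfl⟩ := ν.mem_puncturedTubes_iff.1 hx
    ext1
    have h1 : ((ν.fwdB (ν.toFun i q) : ↥(ballTimesSphere ι k l)) :
        DiscreteIndex ι × ((𝔼 (k + 1)) × (𝕊 l))).2.1 ≠ 0 := by
      rw [ν.coe_fwdB_apply hq1, ← norm_ne_zero_iff, SphereSurgery.norm_polar_fst, norm_ne_zero_iff]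
      exact hq0
    show (ν.bwdA (SphereSurgery.ofHandle ι k l hkl (SphereSurgery.toHandle ι k l hkl
      (ν.fwdB (ν.toFun i q))) : DiscreteIndex ι × ((𝔼 (k + 1)) × (𝕊 l))) : X) = ν.toFun i q
    rw [SphereSurgery.ofHandle_toHandle, ν.coe_bwdA_apply h1, ν.coe_fwdB_apply hq1]
    show ν.toFun (DiscreteIndex.mk.symm (DiscreteIndex.mk i)) _ = _
    rw [SphereSurgery.polarInv_polar hq0]
    rfl
  right_inv' := by
    intro b hb
    have hb1 : ‖(SphereSurgery.polarInv ((SphereSurgery.ofHandle ι k l hkl b :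
        ↥(ballTimesSphere ι k l)) : DiscreteIndex ι × ((𝔼 (k + 1)) × (𝕊 l))).2).2‖ < 1 := by
      rw [SphereSurgery.norm_polarInv_snd]
      exact (mem_ballTimesSphere_iff _).1 (SphereSurgery.ofHandle ι k l hkl b).2
    show SphereSurgery.toHandle ι k l hkl (ν.fwdB (ν.bwdA _ : X)) = b
    conv_rhs => rw [← SphereSurgery.toHandle_ofHandle hkl b]
    congr 1
    ext1
    rw [ν.coe_bwdA_apply hb, ν.coe_fwdB_apply hb1, SphereSurgery.polar_polarInv hb]
    rfl
  open_source := ν.isOpen_puncturedTubes.preimage continuous_subtype_val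
  open_target := (isOpen_ne.preimage (continuous_fst.comp (continuous_snd.comp
    (continuous_subtype_val.comp (SphereSurgery.continuous_ofHandle hkl)))))
  continuousOn_toFun :=
    (SphereSurgery.continuous_toHandle hkl).comp_continuousOn ν.contMDiffOn_fwdB.continuousOn
  continuousOn_invFun := ν.contMDiffOn_bwdA.continuousOn.comp
    (continuous_subtype_val.comp (SphereSurgery.continuous_ofHandle hkl)).continuousOn fun _ hb ↦ hb

/-- The source of the gluing map is the gluing region `⋃ᵢ φᵢ(Sᵏ × (Bˡ⁺¹ ∖ 0))`. [folklore] -/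
theorem glue_source : (ν.glue hkl).source = {a : ↥ν.complement | (a : X) ∈ ν.puncturedTubes} := rfl

/-- The target of the gluing map is the complement of the cores of the handle piece. [folklore] -/
theorem glue_target : (ν.glue hkl).target = {b : SphereSurgery.Handle ι k l hkl |
    ((SphereSurgery.ofHandle ι k l hkl b : ↥(ballTimesSphere ι k l)) :
      DiscreteIndex ι × ((𝔼 (k + 1)) × (𝕊 l))).2.1 ≠ 0} := rfl

/-- The gluing map is `SphereSurgery.toHandle ∘ fwdB`. [folklore] -/
theorem glue_apply (a : ↥ν.complement) :
    ν.glue hkl a = SphereSurgery.toHandle ι k l hkl (ν.fwdB a) := rfl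

/-- The inverse gluing map is `bwdA ∘ SphereSurgery.ofHandle`. [folklore] -/
theorem glue_symm_apply (b : SphereSurgery.Handle ι k l hkl) :
    (ν.glue hkl).symm b =
      ν.bwdA (SphereSurgery.ofHandle ι k l hkl b : DiscreteIndex ι × ((𝔼 (k + 1)) × (𝕊 l))) :=
  rfl

/-- The gluing map is smooth on its source. [folklore] -/
theorem contMDiffOn_glue :
    ContMDiffOn (𝓡∂ (n + 1)) (𝓡∂ (n + 1)) ∞ (ν.glue hkl) (ν.glue hkl).source :=
  (SphereSurgery.contMDiff_toHandle hkl).comp_contMDiffOn ν.contMDiffOn_fwdB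

/-- The inverse gluing map is smooth on its source. [folklore] -/
theorem contMDiffOn_glue_symm :
    ContMDiffOn (𝓡∂ (n + 1)) (𝓡∂ (n + 1)) ∞ (ν.glue hkl).symm (ν.glue hkl).target :=
  ν.contMDiffOn_bwdA.comp
    ((contMDiff_subtype_val.comp (SphereSurgery.contMDiff_ofHandle hkl)).contMDiffOn) fun _ hb ↦ hb

/-- **The gluing datum of the surgery along `ν`** (both pieces modelled on `𝓡∂ (n + 1)`).
[cite: MilnorHCobordism1965, Def. 3.11 (PDF p. 17), §3 (PDF p. 21)] -/
def glueData :
    SmoothGlueData (𝓡∂ (n + 1)) (𝓡∂ (n + 1)) (↥ν.complement) (SphereSurgery.Handle ι k l hkl)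
      (𝔼 (n + 1)) where
  glue := ν.glue hkl
  contMDiffOn_glue := ν.contMDiffOn_glue hkl
  contMDiffOn_glue_symm := ν.contMDiffOn_glue_symm hkl
  linA := ContinuousLinearEquiv.refl ℝ (𝔼 (n + 1))
  linB := ContinuousLinearEquiv.refl ℝ (𝔼 (n + 1))

/-- The gluing map of the surgery datum is `ν.glue`. [folklore] -/
@[simp] theorem glueData_glue : (ν.glueData hkl).glue = ν.glue hkl := rfl

/-- **The gluing datum realises Milnor's identification `sphereFamilySurgeryRel ν`** (read
through `SphereSurgery.toHandle`). [cite: MilnorHCobordism1965, Def. 3.11 (PDF p. 17)] -/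
theorem sphereFamilySurgeryRel_iff (a : ↥ν.complement) (b : ↥(ballTimesSphere ι k l)) :
    sphereFamilySurgeryRel ν a b ↔
      a ∈ (ν.glueData hkl).glue.source ∧
        (ν.glueData hkl).glue a = SphereSurgery.toHandle ι k l hkl b := by
  rw [glueData_glue, glue_source, mem_setOf_eq, glue_apply,
    (SphereSurgery.bijective_toHandle hkl).1.eq_iff]
  obtain ⟨⟨j, y, v⟩, hb⟩ := b
  constructor
  · rintro ⟨u, θ, hθ, hy, ha⟩
    simp only at hy ha
    have hq : ((u, θ • (v : 𝔼 (l + 1))) : (𝕊 k) × (𝔼 (l + 1))).2 ≠ 0 ∧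
        ‖((u, θ • (v : 𝔼 (l + 1))) : (𝕊 k) × (𝔼 (l + 1))).2‖ < 1 := by
      simp only [norm_smul_coe_sphere hθ.1.le, ne_eq, smul_eq_zero, hθ.1.ne', false_or]
      exact ⟨ne_zero_of_mem_unit_sphere _, hθ.2⟩
    refine ⟨ha ▸ ν.apply_mem_puncturedTubes_iff.2 hq, ?_⟩
    ext1
    rw [ha, ν.coe_fwdB_apply hq.2, SphereSurgery.polar_smul u hθ.1 v]
    show _ = (j, y, v)
    rw [hy]
    rfl
  · rintro ⟨ha, hab⟩
    obtain ⟨i, ⟨u, w⟩, hw0, hw1, hx⟩ := ν.mem_puncturedTubes_iff.1 ha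
    have hab' := congrArg Subtype.val hab
    rw [← hx, ν.coe_fwdB_apply hw1] at hab'
    simp only [Prod.mk.injEq] at hab'
    obtain ⟨rfl, hyv⟩ := hab'
    refine ⟨u, ‖w‖, ⟨norm_pos_iff.2 hw0, hw1⟩, ?_, ?_⟩
    · show y = ‖w‖ • (u : 𝔼 (k + 1))
      exact (congrArg Prod.fst hyv).symm
    · show (a : X) =
        ν.toFun (DiscreteIndex.mk.symm (DiscreteIndex.mk i)) (u, ‖w‖ • (v : 𝔼 (l + 1)))
      rw [← hx]
      have hv : radialProjection (spherePt l) w = v := congrArg Prod.snd hyv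
      rw [← hv, norm_smul_coe_radialProjection]
      rfl


/-! ### Separation: the graph of the gluing map is closed -/

/-- The parametrisation `(i, u, t, v) ↦ (φᵢ (u, t • v), (i, t • u, v))` of the closure of the graph
of the gluing map by the compact space `ι × Sᵏ × [0, 1] × Sˡ`. [folklore] -/
def graphParam (r : DiscreteIndex ι × ((𝕊 k) × ((Icc (0 : ℝ) 1) × (𝕊 l)))) :
    X × (DiscreteIndex ι × ((𝔼 (k + 1)) × (𝕊 l))) :=
  (ν.toFun (DiscreteIndex.mk.symm r.1) (r.2.1, (r.2.2.1 : ℝ) • (r.2.2.2 : 𝔼 (l + 1))),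
    (r.1, ((r.2.2.1 : ℝ) • (r.2.1 : 𝔼 (k + 1)), r.2.2.2)))

omit [T2Space X] [Finite ι] [Nonempty ι] in
/-- The parametrisation of the closure of the graph is continuous. [folklore] -/
theorem continuous_graphParam : Continuous ν.graphParam := by
  have ht : Continuous fun r : DiscreteIndex ι × ((𝕊 k) × ((Icc (0 : ℝ) 1) × (𝕊 l))) ↦
      (r.2.2.1 : ℝ) := continuous_subtype_val.comp (continuous_fst.comp continuous_snd.snd)
  have hu : Continuous fun r : DiscreteIndex ι × ((𝕊 k) × ((Icc (0 : ℝ) 1) × (𝕊 l))) ↦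
      (r.2.1 : 𝔼 (k + 1)) := continuous_subtype_val.comp continuous_snd.fst
  have hv : Continuous fun r : DiscreteIndex ι × ((𝕊 k) × ((Icc (0 : ℝ) 1) × (𝕊 l))) ↦
      (r.2.2.2 : 𝔼 (l + 1)) := continuous_subtype_val.comp continuous_snd.snd.snd
  -- `(j, q) ↦ φ_j q` is continuous on the product with the discrete index manifold
  have hc : Continuous fun p : DiscreteIndex ι × ((𝕊 k) × (𝔼 (l + 1))) ↦
      ν.toFun (DiscreteIndex.mk.symm p.1) p.2 :=
    continuous_prod_of_discrete_left.2 fun j ↦ ν.continuous _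
  exact (hc.comp (continuous_fst.prodMk (continuous_snd.fst.prodMk (ht.smul hv)))).prodMk
    (continuous_fst.prodMk ((ht.smul hu).prodMk continuous_snd.snd.snd))

/-- **The graph of the gluing map is closed** in `(X ∖ cores) × Handle`: it is the trace of the
compact set `graphParam (ι × Sᵏ × [0, 1] × Sˡ)`, whose extra points (`t = 0`: on the cores;
`t = 1`: on `ι × ∂D^{k+1} × Sˡ`) lie outside the two open pieces.  This is the Hausdorff
condition of the surgery pushout. [folklore] -/
theorem isClosed_graph : IsClosed {p : ↥ν.complement × SphereSurgery.Handle ι k l hkl |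
    p.1 ∈ (ν.glueData hkl).glue.source ∧ (ν.glueData hkl).glue p.1 = p.2} := by
  have hc : IsClosed (range ν.graphParam) := (isCompact_range ν.continuous_graphParam).isClosed
  have hcont : Continuous fun p : ↥ν.complement × SphereSurgery.Handle ι k l hkl ↦
      ((p.1 : X), ((SphereSurgery.ofHandle ι k l hkl p.2 : ↥(ballTimesSphere ι k l)) :
        DiscreteIndex ι × ((𝔼 (k + 1)) × (𝕊 l)))) :=
    continuous_subtype_val.fst'.prodMk
      ((continuous_subtype_val.comp (SphereSurgery.continuous_ofHandle hkl)).comp continuous_snd)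
  convert hc.preimage hcont using 1
  ext ⟨a, b⟩
  obtain ⟨b, rfl⟩ := (SphereSurgery.bijective_toHandle hkl).2 b
  rw [mem_setOf_eq, ← sphereFamilySurgeryRel_iff]
  simp only [mem_preimage, mem_range, SphereSurgery.ofHandle_toHandle]
  obtain ⟨⟨j, y, v⟩, hb⟩ := b
  constructor
  · rintro ⟨u, t, ht, hy, ha⟩
    refine ⟨(j, u, ⟨t, ht.1.le, ht.2.le⟩, v), ?_⟩
    simp only [graphParam, Prod.mk.injEq]
    exact ⟨ha.symm, trivial, hy.symm, trivial⟩
  · rintro ⟨⟨j', u, ⟨t, ht0, ht1⟩, v'⟩, h⟩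
    simp only [graphParam, Prod.mk.injEq] at h
    obtain ⟨ha, rfl, hy, rfl⟩ := h
    have ht0' : 0 < t := by
      rcases ht0.lt_or_eq with h | rfl
      · exact h
      · exfalso
        refine a.2 (ν.mem_cores_iff.2 ⟨DiscreteIndex.mk.symm j', u, ?_⟩)
        rw [← ha, sphere_apply, zero_smul]
    have ht1' : t < 1 := by
      rcases ht1.lt_or_eq with h | rfl
      · exact h
      · exfalso
        have hb2 := (mem_ballTimesSphere_iff _).1 hb
        rw [← hy, norm_smul_coe_sphere zero_le_one] at hb2
        exact lt_irrefl _ hb2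
    exact ⟨u, t, ⟨ht0', ht1'⟩, hy.symm, ha.symm⟩

/-! ### Compactness: two compact pieces cover the glued space -/

/-- The open union of the half-tubes `φᵢ(Sᵏ × ½Bˡ⁺¹)`. [folklore] -/
def halfTubes : Set X := ⋃ i, ν.toFun i '' {q | ‖q.2‖ < 2⁻¹}

omit [T2Space X] [Finite ι] [Nonempty ι] in
/-- The union of the half-tubes is open. [folklore] -/
theorem isOpen_halfTubes : IsOpen ν.halfTubes :=
  isOpen_iUnion fun i ↦ (ν.isOpenEmbedding i).isOpenMap _
    (isOpen_lt (continuous_norm.comp continuous_snd) continuous_const)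

omit [T2Space X] [Finite ι] [Nonempty ι] in
/-- `φᵢ q` lies in the union of the half-tubes iff `‖q.2‖ < ½`. [folklore] -/
theorem apply_mem_halfTubes_iff {i : ι} {q : (𝕊 k) × (𝔼 (l + 1))} :
    ν.toFun i q ∈ ν.halfTubes ↔ ‖q.2‖ < 2⁻¹ := by
  simp only [halfTubes, mem_iUnion, mem_image, mem_setOf_eq]
  constructor
  · rintro ⟨j, q', hq', h⟩
    by_cases hji : j = i
    · subst hji
      obtain rfl := ν.injective j h
      exact hq'
    · exact (ν.apply_ne_apply hji q' q h).elim
  · exact fun h ↦ ⟨i, q, h, rfl⟩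

omit [T2Space X] [Finite ι] [Nonempty ι] in
/-- The cores lie in the union of the half-tubes. [folklore] -/
theorem cores_subset_halfTubes : ν.cores ⊆ ν.halfTubes := by
  intro x hx
  obtain ⟨i, v, rfl⟩ := ν.mem_cores_iff.1 hx
  rw [sphere_apply, apply_mem_halfTubes_iff, norm_zero]
  norm_num

/-- The compact piece `X ∖ ⋃ᵢ φᵢ(Sᵏ × ½Bˡ⁺¹)` of the first piece, seen in `X ∖ cores`. [folklore] -/
def cptA : Set ↥ν.complement := {a | (a : X) ∉ ν.halfTubes}

omit [Nonempty ι] in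
/-- `X ∖ ⋃ᵢ φᵢ(Sᵏ × ½Bˡ⁺¹)` is compact (for compact `X`). [folklore] -/
theorem isCompact_cptA [CompactSpace X] : IsCompact ν.cptA := by
  refine Topology.IsInducing.subtypeVal.isCompact_preimage'
    ν.isOpen_halfTubes.isClosed_compl.isCompact ?_
  intro x hx
  exact ⟨⟨x, fun h ↦ hx (ν.cores_subset_halfTubes h)⟩, rfl⟩

/-- A point of `X ∖ cores` outside the compact piece is glued to a point of `ι × ½D^{k+1} × Sˡ`.
[folklore] -/
theorem forall_not_mem_cptA (a : ↥ν.complement) (ha : a ∉ ν.cptA) :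
    a ∈ (ν.glue hkl).source ∧ ν.glue hkl a ∈ SphereSurgery.handleCpt (ι := ι) hkl := by
  simp only [cptA, mem_setOf_eq, not_not] at ha
  obtain ⟨i, ⟨u, w⟩, hw, hwa⟩ : ∃ i q, ‖(q : (𝕊 k) × (𝔼 (l + 1))).2‖ < 2⁻¹ ∧ ν.toFun i q = a := by
    simpa only [halfTubes, mem_iUnion, mem_image, mem_setOf_eq] using ha
  have hw' : ‖w‖ < 2⁻¹ := hw
  have hw0 : w ≠ 0 := by
    rintro rfl
    exact a.2 (ν.mem_cores_iff.2 ⟨i, u, hwa⟩)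
  have hw1 : ‖w‖ < 1 := hw'.trans (by norm_num)
  constructor
  · rw [glue_source, mem_setOf_eq, ← hwa, apply_mem_puncturedTubes_iff]
    exact ⟨hw0, hw1⟩
  · rw [glue_apply, SphereSurgery.handleCpt]
    refine Set.mem_image_of_mem (SphereSurgery.toHandle ι k l hkl) ?_
    rw [mem_setOf_eq, ← hwa, ν.coe_fwdB_apply (q := (u, w)) hw1, SphereSurgery.norm_polar_fst]
    exact hw'.le

/-- A point of the handle outside `ι × ½D^{k+1} × Sˡ` is glued to a point of the compact piece
of `X ∖ cores`. [folklore] -/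
theorem forall_not_mem_cptB (b : SphereSurgery.Handle ι k l hkl)
    (hb : b ∉ SphereSurgery.handleCpt (ι := ι) hkl) :
    b ∈ (ν.glue hkl).target ∧ (ν.glue hkl).symm b ∈ ν.cptA := by
  obtain ⟨b, rfl⟩ := (SphereSurgery.bijective_toHandle hkl).2 b
  have hb' : 2⁻¹ < ‖(b : DiscreteIndex ι × ((𝔼 (k + 1)) × (𝕊 l))).2.1‖ := by
    by_contra h
    exact hb ⟨b, not_lt.1 h, rfl⟩
  have hb0 : (b : DiscreteIndex ι × ((𝔼 (k + 1)) × (𝕊 l))).2.1 ≠ 0 := by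
    rw [← norm_pos_iff]; exact hb'.trans' (by norm_num)
  refine ⟨hb0, ?_⟩
  rw [cptA, mem_setOf_eq, glue_symm_apply, SphereSurgery.ofHandle_toHandle, ν.coe_bwdA_apply hb0,
    apply_mem_halfTubes_iff, SphereSurgery.norm_polarInv_snd, not_lt]
  exact hb'.le

/-! ### The surgered manifold -/

variable [IsManifold (𝓡∂ (n + 1)) ∞ X]

/-- **The manifold obtained from `X` by surgery along the framed family `ν`**,
`χ(X, φ₁, …, φ_k) = (X ∖ ⋃ᵢ φᵢ(Sᵏ × 0)) ∪ (ι × OD^{k+1} × Sˡ)` glued along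
`φᵢ(u, θv) ∼ (i, θu, v)` (Milnor 1965, Def. 3.11 and §3 p. 21), as the glued space of the
surgery datum: a `C^∞` manifold with boundary modelled on `𝓡∂ (n + 1)`
(`GluingConstructionBoundary.lean`).
[cite: MilnorHCobordism1965, Def. 3.11 (PDF p. 17), §3 (PDF p. 21)] -/
abbrev Surgered : Type u := (ν.glueData hkl).Glued

/-- The surgered manifold is Hausdorff (closed graph of the gluing map). [folklore] -/
instance t2Space_surgered : T2Space (ν.Surgered hkl) :=
  (ν.glueData hkl).t2Space_of_isClosed_graph (ν.isClosed_graph hkl)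

/-- The surgered manifold of a compact manifold is compact. [folklore] -/
instance compactSpace_surgered [CompactSpace X] : CompactSpace (ν.Surgered hkl) :=
  (ν.glueData hkl).compactSpace_of_forall_not_mem ν.isCompact_cptA
    (SphereSurgery.isCompact_handleCpt hkl) (ν.forall_not_mem_cptA hkl) (ν.forall_not_mem_cptB hkl)

/-- The surgered manifold of a compact manifold is second countable. [folklore] -/
instance secondCountable_surgered [CompactSpace X] : SecondCountableTopology (ν.Surgered hkl) :=
  (ν.glueData hkl).secondCountableTopologyH

/-- **The surgered manifold is an open gluing of `X ∖ cores` and `ι × OD^{k+1} × Sˡ` along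
Milnor's identification**, with the explicit witnesses `inl` and `inr ∘ toHandle`.
[cite: MilnorHCobordism1965, Def. 3.11 (PDF p. 17), §3 (PDF p. 21)] -/
theorem isOpenGluingWith_surgered :
    IsOpenGluingWith (𝓡∂ (n + 1)) (SphereSurgery.handleModelWithCorners k l) (𝓡∂ (n + 1))
      (A := ↥ν.complement) (B := ↥(ballTimesSphere ι k l)) (P := ν.Surgered hkl)
      (sphereFamilySurgeryRel ν) (ν.glueData hkl).inl
      ((ν.glueData hkl).inr ∘ SphereSurgery.toHandle ι k l hkl) := by
  refine ⟨(ν.glueData hkl).isSmoothEmbedding_inlH, (ν.glueData hkl).isOpen_range_inl,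
    (ν.glueData hkl).isSmoothEmbedding_inr_compH (SphereSurgery.isSmoothEmbedding_toHandle hkl),
    ?_, ?_, fun a b ↦ ?_⟩
  · rw [range_comp, SphereSurgery.range_toHandle, image_univ]
    exact (ν.glueData hkl).isOpen_range_inr
  · rw [range_comp, SphereSurgery.range_toHandle, image_univ]
    exact (ν.glueData hkl).range_inl_union_range_inr
  · rw [comp_apply, (ν.glueData hkl).inl_eq_inr_iff, ν.sphereFamilySurgeryRel_iff hkl]

/-- **Surgery along a framed family of spheres in a manifold with boundary exists**: the
surgered manifold `ν.Surgered` *is* obtained from `X` by surgery along `ν` in the sense of the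
relational predicate `FramedSphereFamily.IsSurgery` (Milnor 1965, Def. 3.11, §3 p. 21).
[cite: MilnorHCobordism1965, Def. 3.11 (PDF p. 17), §3 (PDF p. 21)] -/
theorem isSurgery_surgered : ν.IsSurgery (𝓡∂ (n + 1)) (ν.Surgered hkl) :=
  (ν.isOpenGluingWith_surgered hkl).isOpenGluing

/-! ### The boundary of the surgered manifold -/

omit [Nonempty ι] [IsManifold (𝓡∂ (n + 1)) ∞ X] in
/-- A point of `X ∖ cores` is a boundary point iff it is a boundary point of `X`. [folklore] -/
theorem isBoundaryPoint_complement_iff (a : ↥ν.complement) :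
    (𝓡∂ (n + 1)).IsBoundaryPoint a ↔ (a : X) ∈ (𝓡∂ (n + 1)).boundary X :=
  (𝓡∂ (n + 1)).isBoundaryPoint_iff_isBoundaryPoint_val

/-- **Surgery in the interior does not change the boundary**: the boundary of the surgered
manifold is the image under `inl` of the boundary of `X` (which lies in `X ∖ cores`,
`boundary_subset_complement`), the handle having no boundary.  Kosinski 1993, X.2, p. 201
("surgeries … affect neither the boundary of `M` nor its framing"); Kervaire–Milnor 1963, §5.
[cite: Kosinski1993, Ch. X §2, p. 201] -/
theorem boundary_surgered_eq :
    (𝓡∂ (n + 1)).boundary (ν.Surgered hkl) =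
      (ν.glueData hkl).inl '' {a : ↥ν.complement | (a : X) ∈ (𝓡∂ (n + 1)).boundary X} := by
  have hA : (𝓡∂ (n + 1)).boundary (↥ν.complement) =
      {a : ↥ν.complement | (a : X) ∈ (𝓡∂ (n + 1)).boundary X} :=
    Set.ext fun a ↦ ν.isBoundaryPoint_complement_iff a
  have hB : (𝓡∂ (n + 1)).boundary (SphereSurgery.Handle ι k l hkl) = ∅ :=
    HalfSpaceCharted.boundary_eq_empty
  rw [(ν.glueData hkl).boundary_glued_eq, hA, hB, image_empty, union_empty]

/-- `inl a` is a boundary point of the surgered manifold iff `a` is a boundary point of `X`.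
[folklore] -/
theorem inl_mem_boundary_surgered_iff (a : ↥ν.complement) :
    (ν.glueData hkl).inl a ∈ (𝓡∂ (n + 1)).boundary (ν.Surgered hkl) ↔
      (a : X) ∈ (𝓡∂ (n + 1)).boundary X := by
  rw [boundary_surgered_eq, (ν.glueData hkl).inl_injective.mem_set_image]
  rfl

end Glue

end FramedSphereFamily

/-! ### Surgery on a null-cobordism: the boundary is unchanged -/

namespace NullCobordism

variable {n k l : ℕ} {M : Type u} [TopologicalSpace M] [ChartedSpace (𝔼 n) M]
  (c : NullCobordism.{u} n M) {ι : Type u} [Finite ι] [Nonempty ι]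
  (ν : FramedSphereFamily (𝓡∂ (n + 1)) c.W ι k (l + 1)) (hkl : k + l = n)

include hkl

omit [Nonempty ι] in
/-- The boundary `M = ∂W` misses the cores of a framed family in `W` (the tubes lie in the
interior). [cite: Kosinski1993, Ch. X §2, p. 201] -/
theorem incl_mem_complement (x : M) : c.incl x ∈ ν.complement :=
  ν.boundary_subset_complement hkl (c.incl_mem_boundary x)

/-- The boundary inclusion `M → W ∖ cores`. [folklore] -/
def surgeryInclA (x : M) : ↥ν.complement := ⟨c.incl x, c.incl_mem_complement ν hkl x⟩

omit [Nonempty ι] in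
/-- The underlying point of `surgeryInclA x` is `incl x` (definitional). [folklore] -/
@[simp] theorem coe_surgeryInclA (x : M) : (c.surgeryInclA ν hkl x : c.W) = c.incl x := rfl

omit [Nonempty ι] in
/-- `surgeryInclA` is a smooth embedding (corestriction of the boundary embedding to the open
subset `W ∖ cores`). [folklore] -/
theorem isSmoothEmbedding_surgeryInclA [IsManifold (𝓡 n) ∞ M] :
    Manifold.IsSmoothEmbedding (𝓡 n) (𝓡∂ (n + 1)) ∞ (c.surgeryInclA ν hkl) :=
  c.isSmoothEmbedding_incl.codRestrict_opens ν.complement (c.incl_mem_complement ν hkl)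

/-- **The boundary inclusion `M → χ(W, ν)`** of the surgered null-cobordism: `M ⊆ W ∖ cores ⊆ χ`.
[cite: Kosinski1993, Ch. X §2, p. 201] -/
def surgeryIncl (x : M) : ν.Surgered hkl := (ν.glueData hkl).inl (c.surgeryInclA ν hkl x)

/-- `surgeryIncl = inl ∘ surgeryInclA` (definitional). [folklore] -/
theorem surgeryIncl_apply (x : M) :
    c.surgeryIncl ν hkl x = (ν.glueData hkl).inl (c.surgeryInclA ν hkl x) := rfl

/-- The boundary inclusion of the surgered null-cobordism is a smooth embedding. [folklore] -/
theorem isSmoothEmbedding_surgeryIncl [IsManifold (𝓡 n) ∞ M] :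
    Manifold.IsSmoothEmbedding (𝓡 n) (𝓡∂ (n + 1)) ∞ (c.surgeryIncl ν hkl) :=
  (ν.glueData hkl).isSmoothEmbedding_inl_compH (c.isSmoothEmbedding_surgeryInclA ν hkl)

/-- **The boundary inclusion of the surgered null-cobordism is onto its boundary**
(`bχ(W, ν) = bW = M`). [cite: Kosinski1993, Ch. X §2, p. 201] -/
theorem range_surgeryIncl :
    range (c.surgeryIncl ν hkl) = (𝓡∂ (n + 1)).boundary (ν.Surgered hkl) := by
  rw [ν.boundary_surgered_eq hkl]
  ext p
  constructor
  · rintro ⟨x, rfl⟩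
    exact ⟨c.surgeryInclA ν hkl x, c.incl_mem_boundary x, rfl⟩
  · rintro ⟨a, ha, rfl⟩
    obtain ⟨x, hx⟩ : (a : c.W) ∈ range c.incl := by rw [c.range_incl]; exact ha
    refine ⟨x, ?_⟩
    rw [surgeryIncl_apply]
    congr 1
    exact Subtype.ext hx

/-- **Surgery on a null-cobordism.**  If `M = ∂W` (`c : NullCobordism n M`) and `ν` is a framed
family of disjoint `k`-spheres with `(l+1)`-dimensional fibre in `W`, `k + l = n`, then surgery
along `ν` yields again a null-cobordism of `M`, with total space `χ(W, ν) = ν.Surgered`: the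
surgery happens in the interior and the boundary is unchanged.  Kosinski, *Differential
Manifolds* (1993), X.2, p. 201: "surgeries … are performed in the interior and affect neither the
boundary of `M` nor its framing"; Kervaire–Milnor 1963, §5 (spherical modifications of a
manifold with boundary `(M, bM)`). [cite: Kosinski1993, Ch. X §2, p. 201] -/
def surgery [IsManifold (𝓡 n) ∞ M] : NullCobordism n M where
  W := ν.Surgered hkl
  incl := c.surgeryIncl ν hkl
  isSmoothEmbedding_incl := c.isSmoothEmbedding_surgeryIncl ν hkl
  range_incl := c.range_surgeryIncl ν hkl

/-- The total space of the surgered null-cobordism is the surgered manifold (definitional).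
[folklore] -/
theorem surgery_W [IsManifold (𝓡 n) ∞ M] : (c.surgery ν hkl).W = ν.Surgered hkl := rfl

/-- The boundary inclusion of the surgered null-cobordism is `inl ∘ incl` (definitional).
[folklore] -/
theorem surgery_incl [IsManifold (𝓡 n) ∞ M] (x : M) :
    (c.surgery ν hkl).incl x = (ν.glueData hkl).inl (c.surgeryInclA ν hkl x) := rfl

/-- **The surgered null-cobordism is obtained from `W` by surgery along `ν`** (relational form,
with the explicit gluing maps `inl`, `inr ∘ toHandle`).
[cite: MilnorHCobordism1965, Def. 3.11 (PDF p. 17), §3 (PDF p. 21)] -/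
theorem isOpenGluingWith_surgery [IsManifold (𝓡 n) ∞ M] :
    IsOpenGluingWith (𝓡∂ (n + 1)) (SphereSurgery.handleModelWithCorners k l) (𝓡∂ (n + 1))
      (A := ↥ν.complement) (B := ↥(ballTimesSphere ι k l)) (P := (c.surgery ν hkl).W)
      (sphereFamilySurgeryRel ν) (ν.glueData hkl).inl
      ((ν.glueData hkl).inr ∘ SphereSurgery.toHandle ι k l hkl) :=
  ν.isOpenGluingWith_surgered hkl

/-- The surgered null-cobordism is obtained from `W` by surgery along `ν`
(`FramedSphereFamily.IsSurgery`).
[cite: MilnorHCobordism1965, Def. 3.11 (PDF p. 17), §3 (PDF p. 21)] -/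
theorem isSurgery_surgery [IsManifold (𝓡 n) ∞ M] :
    ν.IsSurgery (𝓡∂ (n + 1)) (c.surgery ν hkl).W :=
  ν.isSurgery_surgered hkl

end NullCobordism

end Literature.Topology.FourManifolds
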